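import Mathlib
import HarnessLib

/-!
# Invariant alternating forms with a multiplier — linear algebra for stub `stub_symplecticFormFp`
(line `burkhardt-weddle-two-three-anchor`, crux stmt-Langlands-13640)

Self-contained support file (generic linear algebra over fields, no Galois theory, no new definitions)
for the proof of the registered stub `stub_symplecticFormFp` in
`PhantomRMYoshidaStableYoshidaCongruenceSymplecticFormFp.lean` (worker of line lead c1, 2026-08-16).
Throughout, an **invariant alternating form** for a family `M : Γ → Mₘ(K)` with multiplier `c : Γ → K`
is a matrix `J` with `Jᵀ = -J ∧ ∀ g, M(g)ᵀ J M(g) = c(g) • J` (spelled out in every statement; for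
`M = ρ̄` and `det J ≠ 0` this is the tree's `IsSymplecticWithMultiplierFun` unfolded).

* closure under addition (`isAltInv_add`) and the three transports: change of frame `J ↦ P'ᵀ J P'`
  (`conj_isAltInv`), reindexing (`reindex_isAltInv_iff`), extension of scalars (`map_isAltInv`);
* **descent of solutions** (`mem_span_map_of_isAltInv`): along a field map `φ : K₀ → K`, every
  invariant form of `M ⊗_φ K` is a `K`-combination of images of `K₀`-rational invariant forms of
  `M` — the defining equations are linear with coefficients in `K₀`, so the coordinates of a
  solution in a `K₀`-basis of `K` are solutions (the "rank is insensitive to field extension" step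
  of the paper proof);
* `2 × 2` facts for `J₂ = (0 1; -1 0)` (always written `!![0, 1; -1, 0]`): `S J₂ Sᵀ =
  Sᵀ J₂ S = det S • J₂`, `J₂ᵀ J₂ = 1`, alternating `2 × 2` matrices are multiples of `J₂` when
  `2 ≠ 0`; and the block forms `a J₂ ⊕ b J₂ = Matrix.fromBlocks (a • J₂) 0 0 (b • J₂)` (lemmas
  `bl_*`): additive, homogeneous, injective, `det = a² b²`, invariant under `S ⊕ S'` with
  multiplier `det S = det S'`.

Sources: folklore linear algebra (Isaacs, *Character theory of finite groups*, Cor. 9.22 for the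
descent principle; Boxer–Calegari–Gee–Pilloni 2021 §2.1 for `GSp₄` and its similitude).
-/

set_option linter.dupNamespace false -- project-wide option; `Summit.Langlands.Langlands` is the mandated namespace

noncomputable section

open scoped Matrix

namespace Summit.Langlands.Langlands.Cruxes.StableYoshidaCongruence.BurkhardtWeddleTwoThreeAnchor

/-! ## Invariant alternating forms with a multiplier: closure and transports -/

section AltInv

variable {Γ K : Type*} [Field K] {l m n : Type*} [Fintype m] [Fintype n]

/-- Invariant alternating forms (fixed `M`, `c`) are closed under addition. [folklore] -/
theorem isAltInv_add {M : Γ → Matrix m m K} {c : Γ → K} {J J' : Matrix m m K}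
    (hJ : Jᵀ = -J ∧ ∀ g, (M g)ᵀ * J * M g = c g • J)
    (hJ' : J'ᵀ = -J' ∧ ∀ g, (M g)ᵀ * J' * M g = c g • J') :
    (J + J')ᵀ = -(J + J') ∧ ∀ g, (M g)ᵀ * (J + J') * M g = c g • (J + J') :=
  ⟨by rw [Matrix.transpose_add, hJ.1, hJ'.1, neg_add], fun g => by
    rw [Matrix.mul_add, Matrix.add_mul, hJ.2 g, hJ'.2 g, smul_add]⟩

/-- Re-bracketing `Aᵀ (Bᵀ J B) A = (BA)ᵀ J (BA)`. [folklore] -/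
theorem transpose_mul_sandwich (A : Matrix n l K) (B : Matrix m n K) (J : Matrix m m K) :
    Aᵀ * (Bᵀ * J * B) * A = (B * A)ᵀ * J * (B * A) := by
  simp only [Matrix.transpose_mul, Matrix.mul_assoc]

/-- **Transport of structure (change of frame).** If `M(g) = P N(g) P'` with `P' P = 1`, then
`J ↦ P'ᵀ J P'` maps `N`-invariant alternating forms to `M`-invariant ones (same multiplier). [folklore] -/
theorem conj_isAltInv [DecidableEq n] {M : Γ → Matrix m m K} {N : Γ → Matrix n n K} {c : Γ → K}
    {P : Matrix m n K} {P' : Matrix n m K} (hMN : ∀ g, M g = P * N g * P') (hPP : P' * P = 1)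
    {J : Matrix n n K} (hJ : Jᵀ = -J ∧ ∀ g, (N g)ᵀ * J * N g = c g • J) :
    (P'ᵀ * J * P')ᵀ = -(P'ᵀ * J * P') ∧
      ∀ g, (M g)ᵀ * (P'ᵀ * J * P') * M g = c g • (P'ᵀ * J * P') := by
  obtain ⟨hJt, hJg⟩ := hJ
  refine ⟨by rw [Matrix.transpose_mul, Matrix.transpose_mul, Matrix.transpose_transpose, hJt,
    Matrix.neg_mul, Matrix.mul_neg, Matrix.mul_assoc], fun g => ?_⟩
  rw [hMN g, transpose_mul_sandwich, ← Matrix.mul_assoc P', ← Matrix.mul_assoc P', hPP,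
    Matrix.one_mul, ← transpose_mul_sandwich, hJg g, Matrix.mul_smul, Matrix.smul_mul]

/-- **Transport along a reindexing** `e : m ≃ n` of rows and columns. [folklore] -/
theorem reindex_isAltInv_iff (e : m ≃ n) {N : Γ → Matrix m m K} {c : Γ → K} {J : Matrix m m K} :
    ((Matrix.reindex e e J)ᵀ = -Matrix.reindex e e J ∧ ∀ g, (Matrix.reindex e e (N g))ᵀ *
        Matrix.reindex e e J * Matrix.reindex e e (N g) = c g • Matrix.reindex e e J) ↔
      (Jᵀ = -J ∧ ∀ g, (N g)ᵀ * J * N g = c g • J) := by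
  have hmul : ∀ A B : Matrix m m K,
      Matrix.reindex e e A * Matrix.reindex e e B = Matrix.reindex e e (A * B) :=
    fun A B => Matrix.submatrix_mul_equiv A B _ _ _
  have htr : ∀ A : Matrix m m K, (Matrix.reindex e e A)ᵀ = Matrix.reindex e e Aᵀ :=
    fun A => Matrix.transpose_reindex _ _ _
  have hsmul : ∀ (a : K) (A : Matrix m m K), a • Matrix.reindex e e A = Matrix.reindex e e (a • A) :=
    fun a A => rfl
  have hneg : ∀ A : Matrix m m K, -Matrix.reindex e e A = Matrix.reindex e e (-A) := fun A => rfl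
  simp only [htr, hmul, hsmul, hneg, Equiv.apply_eq_iff_eq]

/-- **Extension of scalars** `φ : K₀ → K`: an `M`-invariant form over `K₀` gives an `M ⊗ K`-invariant
form over `K`. [folklore] -/
theorem map_isAltInv {K₀ : Type*} [Field K₀] (φ : K₀ →+* K) {M : Γ → Matrix m m K₀} {c : Γ → K₀}
    {J : Matrix m m K₀} (hJ : Jᵀ = -J ∧ ∀ g, (M g)ᵀ * J * M g = c g • J) :
    (J.map φ)ᵀ = -J.map φ ∧ ∀ g, ((M g).map φ)ᵀ * J.map φ * (M g).map φ = φ (c g) • J.map φ := by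
  obtain ⟨hJt, hJg⟩ := hJ
  refine ⟨?_, fun g => ?_⟩
  · rw [← Matrix.transpose_map, hJt]
    exact map_neg φ.toAddMonoidHom.mapMatrix J
  · rw [← Matrix.transpose_map, ← Matrix.map_mul, ← Matrix.map_mul, hJg g]
    exact Matrix.map_smul' _ _ _ (map_mul φ)

end AltInv

/-! ## Descent of solutions (the registered sub-goal; no section variables) -/

/-- **Descent of solutions of a linear system** (registered sub-goal of stmt-Langlands-13640, stated
binder-free).  Every `M ⊗ K`-invariant alternating form is a `K`-linear combination of images of
`K₀`-rational `M`-invariant alternating forms: the defining equations have coefficients in `K₀`, so the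
coordinates of a solution in a `K₀`-basis of `K` are again solutions. [cite: Isaacs1976, Cor. 9.22] -/
theorem mem_span_map_of_isAltInv :
    ∀ {Γ K₀ K : Type} [Field K₀] [Field K] {m : Type} [Fintype m] (φ : K₀ →+* K)
      (M : Γ → Matrix m m K₀) (c : Γ → K₀) {J : Matrix m m K}, Matrix.transpose J = -J →
      (∀ g, Matrix.transpose ((M g).map φ) * J * (M g).map φ = φ (c g) • J) →
      J ∈ Submodule.span K ((fun J₀ : Matrix m m K₀ => J₀.map φ) ''
        {J₀ | Matrix.transpose J₀ = -J₀ ∧ ∀ g, Matrix.transpose (M g) * J₀ * M g = c g • J₀}) := by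
  intro Γ K₀ K _ _ m _ φ M c J hJt hJg
  classical
  letI : Algebra K₀ K := φ.toAlgebra
  have hφ : ∀ (x : K₀) (y : K), φ x * y = x • y := fun x y => (Algebra.smul_def x y).symm
  let b := Module.Free.chooseBasis K₀ K
  -- the matrix of `l`-th coordinates of `J`
  let co : Module.Free.ChooseBasisIndex K₀ K → Matrix m m K₀ := fun l => J.map (b.coord l)
  have hP1 : ∀ (l) (N : Matrix m m K₀) (X : Matrix m m K),
      (N.map φ * X).map (b.coord l) = N * X.map (b.coord l) := by
    intro l N X
    ext i j
    simp only [Matrix.map_apply, Matrix.mul_apply, map_sum, hφ, map_smul, smul_eq_mul]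
  have hP2 : ∀ (l) (N : Matrix m m K₀) (X : Matrix m m K),
      (X * N.map φ).map (b.coord l) = X.map (b.coord l) * N := by
    intro l N X
    ext i j
    simp only [Matrix.map_apply, Matrix.mul_apply, map_sum]
    refine Finset.sum_congr rfl fun a _ => ?_
    rw [mul_comm, hφ, map_smul, smul_eq_mul, mul_comm]
  have hco : ∀ l, (co l)ᵀ = -co l ∧ ∀ g, (M g)ᵀ * co l * M g = c g • co l := fun l => by
    refine ⟨?_, fun g => ?_⟩
    · show (J.map _)ᵀ = -(J.map _)
      rw [← Matrix.transpose_map, hJt]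
      exact map_neg (b.coord l).toAddMonoidHom.mapMatrix J
    · have h1 : (((M g).map φ)ᵀ * J * (M g).map φ).map (b.coord l) =
          (φ (c g) • J).map (b.coord l) := by rw [hJg g]
      rw [← Matrix.transpose_map, hP2, hP1] at h1
      show (M g)ᵀ * J.map _ * M g = c g • J.map _
      rw [h1]
      ext i j
      simp only [Matrix.map_apply, Matrix.smul_apply, smul_eq_mul, hφ, map_smul]
  -- reconstruction of `J` from its coordinates
  let s : Finset (Module.Free.ChooseBasisIndex K₀ K) :=
    Finset.univ.biUnion fun ij : m × m => (b.repr (J ij.1 ij.2)).support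
  have hrec : J = ∑ l ∈ s, b l • (co l).map φ := by
    ext i j
    rw [Matrix.sum_apply]
    simp only [co, Matrix.smul_apply, Matrix.map_apply, smul_eq_mul, Module.Basis.coord_apply]
    conv_lhs => rw [← b.linearCombination_repr (J i j)]
    rw [Finsupp.linearCombination_apply, Finsupp.sum_of_support_subset _ (s := s)]
    · refine Finset.sum_congr rfl fun l _ => ?_
      rw [mul_comm, hφ]
    · exact Finset.subset_biUnion_of_mem (fun ij : m × m => (b.repr (J ij.1 ij.2)).support)
        (Finset.mem_univ (i, j))
    · intro l _
      exact zero_smul _ _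
  rw [hrec]
  exact Submodule.sum_mem _ fun l _ =>
    Submodule.smul_mem _ _ (Submodule.subset_span ⟨co l, hco l, rfl⟩)

/-! ## `2 × 2` linear algebra: the alternating plane form `J₂ = !![0, 1; -1, 0]` and the block forms
`a J₂ ⊕ b J₂ = Matrix.fromBlocks (a • J₂) 0 0 (b • J₂)` (always written out) -/

section TwoByTwo

variable {K : Type*} [Field K]

/-- `J₂ᵀ J₂ = 1` for `J₂ = (0 1; -1 0)`. [folklore] -/
theorem J₂_transpose_mul_J₂ :
    (!![0, 1; -1, 0] : Matrix (Fin 2) (Fin 2) K)ᵀ * !![0, 1; -1, 0] = 1 := by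
  ext i j; fin_cases i <;> fin_cases j <;> simp [Matrix.mul_apply]

/-- `S J₂ Sᵀ = det S • J₂` for every `2 × 2` matrix `S`. [folklore] -/
theorem mul_J₂_mul_transpose (S : Matrix (Fin 2) (Fin 2) K) :
    S * !![0, 1; -1, 0] * Sᵀ = S.det • !![0, 1; -1, 0] := by
  ext i j
  fin_cases i <;> fin_cases j <;>
    simp [Matrix.mul_apply, Fin.sum_univ_two, Matrix.det_fin_two] <;> ring

/-- `Sᵀ J₂ S = det S • J₂` for every `2 × 2` matrix `S` (`GL₂ = GSp₂`: the alternating form on a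
plane is invariant with multiplier the determinant). [folklore] -/
theorem transpose_mul_J₂_mul (S : Matrix (Fin 2) (Fin 2) K) :
    Sᵀ * !![0, 1; -1, 0] * S = S.det • !![0, 1; -1, 0] := by
  ext i j
  fin_cases i <;> fin_cases j <;>
    simp [Matrix.mul_apply, Fin.sum_univ_two, Matrix.det_fin_two] <;> ring

/-- In characteristic `≠ 2`, a `2 × 2` matrix with `Aᵀ = -A` is a multiple of `J₂`. [folklore] -/
theorem eq_smul_J₂_of_transpose_eq_neg (h2 : (2 : K) ≠ 0) {A : Matrix (Fin 2) (Fin 2) K}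
    (hA : Aᵀ = -A) : A = A 0 1 • !![0, 1; -1, 0] := by
  have hd : ∀ i, A i i = 0 := fun i => by
    have e := congr_fun (congr_fun hA i) i
    rw [Matrix.transpose_apply, Matrix.neg_apply] at e
    have : (2 : K) * A i i = 0 := by rw [two_mul]; nth_rewrite 1 [e]; exact neg_add_cancel _
    exact (mul_eq_zero.mp this).resolve_left h2
  have h10 : A 1 0 = -A 0 1 := by
    have e := congr_fun (congr_fun hA 0) 1
    rwa [Matrix.transpose_apply, Matrix.neg_apply] at e
  ext i j
  fin_cases i <;> fin_cases j <;> simp [hd, h10]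

/-- The block forms `a J₂ ⊕ b J₂` are additive in `(a, b)`. [folklore] -/
theorem bl_add (a b a' b' : K) :
    Matrix.fromBlocks (a • !![0, 1; -1, 0]) 0 0 (b • !![0, 1; -1, 0]) +
        Matrix.fromBlocks (a' • !![0, 1; -1, 0]) 0 0 (b' • !![0, 1; -1, 0]) =
      Matrix.fromBlocks ((a + a') • !![0, 1; -1, 0]) 0 0 ((b + b') • (!![0, 1; -1, 0] :
        Matrix (Fin 2) (Fin 2) K)) := by
  rw [Matrix.fromBlocks_add, add_zero, add_smul, add_smul]

/-- The block forms `a J₂ ⊕ b J₂` are homogeneous in `(a, b)`. [folklore] -/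
theorem smul_bl (t a b : K) :
    t • Matrix.fromBlocks (a • !![0, 1; -1, 0]) 0 0 (b • !![0, 1; -1, 0]) =
      Matrix.fromBlocks ((t * a) • !![0, 1; -1, 0]) 0 0 ((t * b) • (!![0, 1; -1, 0] :
        Matrix (Fin 2) (Fin 2) K)) := by
  rw [Matrix.fromBlocks_smul, smul_zero, smul_smul, smul_smul]

/-- The block forms `a J₂ ⊕ b J₂` determine `(a, b)`. [folklore] -/
theorem bl_inj {a b a' b' : K}
    (h : Matrix.fromBlocks (a • !![0, 1; -1, 0]) 0 0 (b • !![0, 1; -1, 0]) =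
      Matrix.fromBlocks (a' • !![0, 1; -1, 0]) 0 0 (b' • (!![0, 1; -1, 0] :
        Matrix (Fin 2) (Fin 2) K))) : a = a' ∧ b = b' := by
  rw [Matrix.fromBlocks_inj] at h
  have h1 := congr_fun (congr_fun h.1 0) 1
  have h2 := congr_fun (congr_fun h.2.2.2 0) 1
  simp at h1 h2
  exact ⟨h1, h2⟩

/-- `det (a J₂ ⊕ b J₂) = a² b²`. [folklore] -/
theorem det_bl (a b : K) :
    (Matrix.fromBlocks (a • !![0, 1; -1, 0]) 0 0 (b • (!![0, 1; -1, 0] :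
      Matrix (Fin 2) (Fin 2) K))).det = a ^ 2 * b ^ 2 := by
  rw [Matrix.det_fromBlocks_zero₂₁, Matrix.det_smul, Matrix.det_smul, Fintype.card_fin]
  simp [Matrix.det_fin_two]

/-- `a J₂ ⊕ b J₂` is an invariant alternating form for `S ⊕ S'` with multiplier `ν` as soon as
`det S = det S' = ν`. [folklore] -/
theorem bl_isAltInv {Γ : Type*} {S S' : Γ → Matrix (Fin 2) (Fin 2) K} {ν : Γ → K}
    (hS : ∀ g, (S g).det = ν g) (hS' : ∀ g, (S' g).det = ν g) (a b : K) :
    (Matrix.fromBlocks (a • !![0, 1; -1, 0]) 0 0 (b • (!![0, 1; -1, 0] :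
        Matrix (Fin 2) (Fin 2) K)))ᵀ =
      -Matrix.fromBlocks (a • !![0, 1; -1, 0]) 0 0 (b • !![0, 1; -1, 0]) ∧
    ∀ g, (Matrix.fromBlocks (S g) 0 0 (S' g))ᵀ *
        Matrix.fromBlocks (a • !![0, 1; -1, 0]) 0 0 (b • !![0, 1; -1, 0]) *
        Matrix.fromBlocks (S g) 0 0 (S' g) =
      ν g • Matrix.fromBlocks (a • !![0, 1; -1, 0]) 0 0 (b • !![0, 1; -1, 0]) := by
  have hJt : (!![0, 1; -1, 0] : Matrix (Fin 2) (Fin 2) K)ᵀ = -!![0, 1; -1, 0] := by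
    ext i j; fin_cases i <;> fin_cases j <;> simp
  refine ⟨?_, fun g => ?_⟩
  · rw [Matrix.fromBlocks_transpose, Matrix.fromBlocks_neg, Matrix.transpose_smul,
      Matrix.transpose_smul, hJt, Matrix.transpose_zero, smul_neg, smul_neg, neg_zero]
  · simp only [Matrix.fromBlocks_transpose, Matrix.fromBlocks_multiply, Matrix.fromBlocks_smul,
      Matrix.transpose_zero, Matrix.zero_mul, Matrix.mul_zero, add_zero, zero_add, Matrix.mul_smul,
      Matrix.smul_mul, transpose_mul_J₂_mul, hS, hS', smul_zero, Matrix.fromBlocks_inj]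
    exact ⟨smul_comm _ _ _, trivial, trivial, smul_comm _ _ _⟩

end TwoByTwo

end Summit.Langlands.Langlands.Cruxes.StableYoshidaCongruence.BurkhardtWeddleTwoThreeAnchor

end
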